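import Mathlib
import Summits.Ventures.PercRepro.PuncturedLYMMixP1Q4Table1
import Summits.Ventures.PercRepro.PuncturedLYMMixP1Q4Cols1

/-!
# PercRepro — (SP) FOR `1` PAIRWISE DISJOINT PAIRS AND `4` PAIRWISE DISJOINT QUADRUPLES AT LEVEL `4`: THE COLUMN IDENTITIES, ASSEMBLED
(p10, gen 41)

`col_check`: the column identity of every free column class (`mass ≤ 5`, the touched bounds), by nested `interval_cases`.  Nothing here asserts (SP).
-/

namespace PercRepro.PuncturedLYM.Split.TypeLift.MixP1Q4

/-- The column identity of every free column class, in one statement. -/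
theorem col_check (n : ℚ) (hd : den n ≠ 0) (d21 d41 d42 d43 : ℕ)
    (h : d21 + d41 + 2 * d42 + 3 * d43 ≤ 5) (hA : d21 ≤ 1) (hB : d41 + d42 + d43 ≤ 4) :
    1 * (d21 : ℚ) * raw n (d21 - 1) d41 d42 d43 0 + 1 * (d41 : ℚ) * raw n d21 (d41 - 1) d42 d43 2 + 2 * (d42 : ℚ) * raw n d21 (d41 + 1) (d42 - 1) d43 3 + 3 * (d43 : ℚ) * raw n d21 d41 (d42 + 1) (d43 - 1) 4 + ((5 : ℚ) - d21 - d41 - 2 * d42 - 3 * d43) * raw n d21 d41 d42 d43 6 = 1 := by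
  have hb4 : d43 ≤ 1 := by omega
  interval_cases d43
  · have hb3 : d42 ≤ 2 := by omega
    interval_cases d42
    · have hb2 : d41 ≤ 4 := by omega
      interval_cases d41
      · have hb1 : d21 ≤ 1 := by omega
        interval_cases d21
        · push_cast
          linear_combination col_0000 n hd
        · push_cast
          linear_combination col_1000 n hd
      · have hb1 : d21 ≤ 1 := by omega
        interval_cases d21
        · push_cast
          linear_combination col_0100 n hd
        · push_cast
          linear_combination col_1100 n hd
      · have hb1 : d21 ≤ 1 := by omega
        interval_cases d21
        · push_cast
          linear_combination col_0200 n hd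
        · push_cast
          linear_combination col_1200 n hd
      · have hb1 : d21 ≤ 1 := by omega
        interval_cases d21
        · push_cast
          linear_combination col_0300 n hd
        · push_cast
          linear_combination col_1300 n hd
      · have hb1 : d21 ≤ 1 := by omega
        interval_cases d21
        · push_cast
          linear_combination col_0400 n hd
        · push_cast
          linear_combination col_1400 n hd
    · have hb2 : d41 ≤ 3 := by omega
      interval_cases d41
      · have hb1 : d21 ≤ 1 := by omega
        interval_cases d21
        · push_cast
          linear_combination col_0010 n hd
        · push_cast
          linear_combination col_1010 n hd
      · have hb1 : d21 ≤ 1 := by omega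
        interval_cases d21
        · push_cast
          linear_combination col_0110 n hd
        · push_cast
          linear_combination col_1110 n hd
      · have hb1 : d21 ≤ 1 := by omega
        interval_cases d21
        · push_cast
          linear_combination col_0210 n hd
        · push_cast
          linear_combination col_1210 n hd
      · have hb1 : d21 ≤ 0 := by omega
        interval_cases d21
        · push_cast
          linear_combination col_0310 n hd
    · have hb2 : d41 ≤ 1 := by omega
      interval_cases d41
      · have hb1 : d21 ≤ 1 := by omega
        interval_cases d21
        · push_cast
          linear_combination col_0020 n hd
        · push_cast
          linear_combination col_1020 n hd
      · have hb1 : d21 ≤ 0 := by omega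
        interval_cases d21
        · push_cast
          linear_combination col_0120 n hd
  · have hb3 : d42 ≤ 1 := by omega
    interval_cases d42
    · have hb2 : d41 ≤ 2 := by omega
      interval_cases d41
      · have hb1 : d21 ≤ 1 := by omega
        interval_cases d21
        · push_cast
          linear_combination col_0001 n hd
        · push_cast
          linear_combination col_1001 n hd
      · have hb1 : d21 ≤ 1 := by omega
        interval_cases d21
        · push_cast
          linear_combination col_0101 n hd
        · push_cast
          linear_combination col_1101 n hd
      · have hb1 : d21 ≤ 0 := by omega
        interval_cases d21
        · push_cast
          linear_combination col_0201 n hd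
    · have hb2 : d41 ≤ 0 := by omega
      interval_cases d41
      · have hb1 : d21 ≤ 0 := by omega
        interval_cases d21
        · push_cast
          linear_combination col_0011 n hd

end PercRepro.PuncturedLYM.Split.TypeLift.MixP1Q4
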